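import Mathlib.Algebra.Module.ZLattice.Basic
import Mathlib.MeasureTheory.Group.FundamentalDomain
import Mathlib.MeasureTheory.Function.Floor
import Mathlib.Probability.Independence.Basic
import Mathlib.Probability.ConditionalProbability
import HarnessLib

/-!
# The combining procedure of Micciancio–Regev 2007 (Lemma 5.8): uniformity of the oracle query

Topic `Algebra/EuclideanLattices` (family `pqc`). Fully PROVED distributional content of
**Micciancio–Regev 2007, Lemma 5.8, first property** ("Combining Procedure", authors' version
pp. 20–21), the companion of `MRCombiningProcedure.lean` (which proves the second and third properties
and leaves the first one aside: "a statement about distributions"). Written for the decomposition of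
the named fact `Literature.Computability.Cryptography.MicciancioRegev2007_gapCVP'_to_SIS'` (MR07
Thm. 5.23 proper) and of `Literature.Computability.Cryptography.owfExist_of_gapSVP_worstCaseHard`:
it is the step "on input a uniformly random matrix `C′ ∈ P(B)ᵐ`, the distribution of the query
`A ∈ ℤ_q^{n×m}` asked by `A_F(B, S, C′, q)` is also uniform" of the proof of Thm. 5.9 (p. 23), used
again through the procedure `W(B, S)` of Thm. 5.23 (p. 29).

The procedure (p. 21): given a lattice `L(B)`, a full-rank sublattice `L(S) ⊆ L(B)` and
`c₁, …, c_m ∈ P(B)`: (1) pick uniformly random `vᵢ ∈ L(B) mod P(S)`, (2) `wᵢ = (vᵢ + cᵢ) mod P(S)`,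
(3) `aᵢ = ⌊q S⁻¹ wᵢ⌋ ∈ ℤ_qⁿ`. Printed proof of the first property (p. 21): "if `c` is uniformly
distributed in `P(B)` and `v` is chosen uniformly from the vectors in `L(B) mod P(S)`, then
`c + v mod P(S)` is distributed uniformly in `P(S)`. This holds since the sets `(v + P(B)) mod P(S)`
for all `v ∈ L(B) mod P(S)` form a partition of `P(S)` into sets of equal volume. Thus … `W` is
distributed uniformly in `P(S)ᵐ`. From this, it easily follows that `A` is distributed uniformly in
`ℤ_q^{n×m}`." In Mathlib's language (`B S : Basis ι ℝ V` real bases of a finite-dimensional real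
normed space `V` with an additive Haar measure `μ`, `L(B) = span_ℤ B`, `L(S) = span_ℤ S ≤ L(B)`,
`P(·) = ZSpan.fundamentalDomain ·`, `x mod P(S) = ZSpan.fract S x`, and a *transversal* `T` of
`L(B)/L(S)` — a finite set of vectors of `L(B)` meeting every coset of `L(S)` exactly once, e.g.
`L(B) ∩ P(S)`):

* `MicciancioRegev2007.sum_measure_inter_preimage_fract_eq` — **the partition of `P(S)` into sets
  of equal volume**, in the form that is actually used: for every set `A`,
  `∑_{v ∈ T} μ {c ∈ P(B) | (c + v) mod P(S) ∈ A} = μ (A ∩ P(S))`;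
  `MicciancioRegev2007.card_mul_measure_fundamentalDomain_eq` — in particular
  `#T · μ(P(B)) = μ(P(S))` (the index `[L(B) : L(S)]` as a ratio of volumes).
* `MicciancioRegev2007.measure_setOf_floor_repr_eq` — **the `qⁿ` cells of `P(S)` have equal
  volume**: `μ {w | ⌊q S⁻¹ w⌋ = a} = μ(P(S)) / qⁿ` for every `a ∈ ℤⁿ`; the cell lies in `P(S)` iff
  `a ∈ {0, …, q-1}ⁿ` (`floor_repr_nonneg`, `floor_repr_lt`, `setOf_floor_repr_eq_subset`).
* `MicciancioRegev2007.measure_query_eq` — **the first property of Lemma 5.8, one column**: on a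
  probability space, if `c` has the uniform law `μ[·|P(B)]` on `P(B)`, `v` is uniform on the
  transversal `T` and independent of `c`, then `a = ⌊q S⁻¹ ((c + v) mod P(S))⌋` takes each value of
  `{0, …, q-1}ⁿ` with probability `q⁻ⁿ`.
* `MicciancioRegev2007.measure_queryMatrix_eq` — **the first property of Lemma 5.8**: for
  independent columns (the pairs `(cᵢ, vᵢ)` independent across `i`, each as above) the query matrix
  `A = [a₁, …, a_m]` takes each value in `{0, …, q-1}^{n×m}` with probability `q^{-nm}`.

Theorems only; no definitions, no named facts. The transversal is an arbitrary finite set with the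
two defining properties (`T ⊆ L(B)`; every `x ∈ L(B)` is congruent modulo `L(S)` to exactly one
element of `T`), so that both the canonical choice `L(B) ∩ P(S)` of the paper
(`MicciancioRegev2007.isTransversal_inter_fundamentalDomain`) and any implementation-friendly
enumeration qualify.

## References

* D. Micciancio, O. Regev, *Worst-case to average-case reductions based on Gaussian measures*,
  SIAM J. Comput. 37 (2007) 267–302; authors' version, Lemma 5.8 (first property) and its proof
  (pp. 20–21), Thm. 5.9 (proof, p. 23: "By Lemma 5.8, on input a uniformly random matrix `C′` … the
  query `A` … is also uniform"), Thm. 5.23 (p. 29) (`lit read doi:10.1137/S0097539705447360`).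
-/

noncomputable section

open MeasureTheory ProbabilityTheory Module Set
open scoped ENNReal Pointwise

namespace Literature.Algebra.EuclideanLattices

namespace MicciancioRegev2007

variable {V : Type*} [NormedAddCommGroup V] [NormedSpace ℝ V] [FiniteDimensional ℝ V]
variable {ι : Type*} [Fintype ι]

/-! ### Transversals of `L(B) / L(S)` ("the vectors in `L(B) mod P(S)`") -/

omit [FiniteDimensional ℝ V] in
/-- **The canonical transversal `L(B) ∩ P(S)`** (MR07 p. 21, step (1): "`vᵢ ∈ L(B) mod P(S)`"): if
`L(S) ⊆ L(B)`, the (finitely many) lattice vectors of `L(B)` lying in the fundamental parallelepiped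
`P(S)` meet every coset of `L(S)` in `L(B)` exactly once (the representative of `x` is
`x mod P(S) = ZSpan.fract S x`). Finiteness of `L(B) ∩ P(S)` is Mathlib's `ZSpan.setFinite_inter`.
[cite: MicciancioRegev2007, Lemma 5.8 (proof, step (1), p. 21)] -/
theorem isTransversal_inter_fundamentalDomain (B S : Basis ι ℝ V)
    (hSB : ∀ j, S j ∈ Submodule.span ℤ (Set.range B))
    (hfin : ((Submodule.span ℤ (Set.range B) : Set V) ∩ ZSpan.fundamentalDomain S).Finite) :
    (↑hfin.toFinset : Set V) ⊆ Submodule.span ℤ (Set.range B) ∧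
      ∀ x ∈ Submodule.span ℤ (Set.range B), ∃! t, t ∈ hfin.toFinset ∧
        x - t ∈ Submodule.span ℤ (Set.range S) := by
  refine ⟨fun t ht => ?_, fun x hx => ?_⟩
  · rw [Set.Finite.coe_toFinset] at ht
    exact ht.1
  · have hSB' : Submodule.span ℤ (Set.range S) ≤ Submodule.span ℤ (Set.range B) :=
      Submodule.span_le.2 (Set.range_subset_iff.2 hSB)
    refine ⟨ZSpan.fract S x, ⟨?_, ?_⟩, ?_⟩
    · rw [Set.Finite.mem_toFinset]
      refine ⟨?_, ZSpan.fract_mem_fundamentalDomain S x⟩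
      rw [ZSpan.fract_apply]
      exact sub_mem hx (hSB' (ZSpan.floor S x).2)
    · rw [ZSpan.fract_apply, sub_sub_cancel]
      exact (ZSpan.floor S x).2
    · rintro t ⟨ht, hxt⟩
      rw [Set.Finite.mem_toFinset] at ht
      have h1 : ZSpan.fract S t = t := (ZSpan.fract_eq_self).2 ht.2
      rw [← h1, ZSpan.fract_eq_fract]
      have : -t + x = x - t := by abel
      rw [this]
      exact hxt

/-- The canonical transversal exists: `L(B) ∩ P(S)` is finite (a discrete set in a bounded one;
Mathlib's `ZSpan.setFinite_inter`). [folklore] -/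
theorem finite_span_inter_fundamentalDomain (B S : Basis ι ℝ V) :
    ((Submodule.span ℤ (Set.range B) : Set V) ∩ ZSpan.fundamentalDomain S).Finite := by
  simpa [Set.inter_comm] using ZSpan.setFinite_inter B (ZSpan.fundamentalDomain_isBounded S)

omit [FiniteDimensional ℝ V] [Fintype ι] in
/-- A transversal of `L(B)/L(S)` is nonempty (it represents the coset of `0`). [folklore] -/
theorem transversal_nonempty (B S : Basis ι ℝ V) {T : Finset V}
    (huniq : ∀ x ∈ Submodule.span ℤ (Set.range B), ∃! t, t ∈ T ∧ x - t ∈ Submodule.span ℤ (Set.range S)) :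
    T.Nonempty := by
  obtain ⟨t, ⟨ht, -⟩, -⟩ := huniq 0 (zero_mem _)
  exact ⟨t, ht⟩

section Partition

variable [MeasurableSpace V] [BorelSpace V] (μ : Measure V) [μ.IsAddHaarMeasure]

omit [FiniteDimensional ℝ V] [MeasurableSpace V] [BorelSpace V] in
/-- Translates of a set by the sublattice, seen through `mod P(S)`: for `ℓ ∈ L(S)`,
`{x | x mod P(S) ∈ A} ∩ (ℓ + P(S)) = ℓ + (A ∩ P(S))`. [folklore] -/
theorem preimage_fract_inter_vadd_fundamentalDomain (S : Basis ι ℝ V) (A : Set V)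
    (ℓ : Submodule.span ℤ (Set.range S)) :
    ZSpan.fract S ⁻¹' A ∩ (ℓ +ᵥ ZSpan.fundamentalDomain S) =
      ℓ +ᵥ (A ∩ ZSpan.fundamentalDomain S) := by
  have hv : ∀ (y : Submodule.span ℤ (Set.range S)) (x : V), y +ᵥ x = (y : V) + x := fun _ _ => rfl
  ext x
  simp only [Set.mem_inter_iff, Set.mem_preimage, Set.mem_vadd_set_iff_neg_vadd_mem, hv]
  have hfr : -(ℓ : V) + x ∈ ZSpan.fundamentalDomain S → ZSpan.fract S x = -(ℓ : V) + x := by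
    intro hF
    have h1 : ZSpan.fract S (-(ℓ : V) + x) = -(ℓ : V) + x := (ZSpan.fract_eq_self).2 hF
    rw [← h1, add_comm, ZSpan.fract_add_ZSpan S x (neg_mem ℓ.2)]
  constructor
  · rintro ⟨hA, hF⟩
    have hF' : -(ℓ : V) + x ∈ ZSpan.fundamentalDomain S := by simpa using hF
    refine ⟨?_, ?_⟩
    · simpa [hfr hF'] using hA
    · simpa using hF'
  · rintro ⟨hA, hF⟩
    have hF' : -(ℓ : V) + x ∈ ZSpan.fundamentalDomain S := by simpa using hF
    have hA' : -(ℓ : V) + x ∈ A := by simpa using hA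
    refine ⟨?_, ?_⟩
    · rw [hfr hF']
      exact hA'
    · simpa using hF'

omit [NormedSpace ℝ V] [FiniteDimensional ℝ V] [Fintype ι] [MeasurableSpace V] [BorelSpace V] in
/-- A translate of a set by a lattice vector, as a preimage under a translation of `V`. [folklore] -/
theorem vadd_set_eq_preimage {L : Submodule ℤ V} (ℓ : L) (A : Set V) :
    (ℓ +ᵥ A : Set V) = (fun x => -(ℓ : V) + x) ⁻¹' A := by
  have hv : ∀ (y : L) (x : V), y +ᵥ x = (y : V) + x := fun _ _ => rfl
  ext x
  rw [Set.mem_vadd_set_iff_neg_vadd_mem, Set.mem_preimage, hv]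
  simp

/-- **MR07 Lemma 5.8, first property — the partition of `P(S)` into sets of equal volume**
(p. 21: "the sets `(v + P(B)) mod P(S)` for all `v ∈ L(B) mod P(S)` form a partition of `P(S)` into
sets of equal volume"), in the form used: for a transversal `T` of `L(B)/L(S)` and every set `A`,
`∑_{v ∈ T} μ {c ∈ P(B) | (c + v) mod P(S) ∈ A} = μ (A ∩ P(S))`. Proof: decompose
`{x | x mod P(S) ∈ A}` along the translates `ℓ + P(S)`, `ℓ ∈ L(S)` (fundamental domain of `L(S)`),
translate, and reassemble the pairs `(v, ℓ) ↦ v - ℓ` into all of `L(B)`, for which `P(B)` is a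
fundamental domain. [cite: MicciancioRegev2007, Lemma 5.8 (first property, proof p. 21)] -/
theorem sum_measure_inter_preimage_fract_eq (B S : Basis ι ℝ V)
    (hSB : ∀ j, S j ∈ Submodule.span ℤ (Set.range B)) {T : Finset V}
    (hT : (↑T : Set V) ⊆ Submodule.span ℤ (Set.range B))
    (huniq : ∀ x ∈ Submodule.span ℤ (Set.range B), ∃! t, t ∈ T ∧ x - t ∈ Submodule.span ℤ (Set.range S))
    (A : Set V) :
    ∑ t ∈ T, μ (ZSpan.fundamentalDomain B ∩ {c | ZSpan.fract S (c + t) ∈ A}) =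
      μ (A ∩ ZSpan.fundamentalDomain S) := by
  classical
  have hSB' : Submodule.span ℤ (Set.range S) ≤ Submodule.span ℤ (Set.range B) :=
    Submodule.span_le.2 (Set.range_subset_iff.2 hSB)
  have fundS : IsAddFundamentalDomain (Submodule.span ℤ (Set.range S)) (ZSpan.fundamentalDomain S) μ :=
    ZSpan.isAddFundamentalDomain S μ
  have fundB : IsAddFundamentalDomain (Submodule.span ℤ (Set.range B)) (ZSpan.fundamentalDomain B) μ :=
    ZSpan.isAddFundamentalDomain B μ
  have : MeasurableVAdd (Submodule.span ℤ (Set.range S)) V :=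
    (inferInstance : MeasurableVAdd (Submodule.span ℤ (Set.range S)).toAddSubgroup V)
  have : VAddInvariantMeasure (Submodule.span ℤ (Set.range S)) V μ :=
    (inferInstance : VAddInvariantMeasure (Submodule.span ℤ (Set.range S)).toAddSubgroup V μ)
  have : MeasurableVAdd (Submodule.span ℤ (Set.range B)) V :=
    (inferInstance : MeasurableVAdd (Submodule.span ℤ (Set.range B)).toAddSubgroup V)
  have : VAddInvariantMeasure (Submodule.span ℤ (Set.range B)) V μ :=
    (inferInstance : VAddInvariantMeasure (Submodule.span ℤ (Set.range B)).toAddSubgroup V μ)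
  -- the summand for `t`, decomposed along `L(S)`
  have hterm : ∀ t : V, μ (ZSpan.fundamentalDomain B ∩ {c | ZSpan.fract S (c + t) ∈ A}) =
      ∑' ℓ : Submodule.span ℤ (Set.range S),
        μ ((A ∩ ZSpan.fundamentalDomain S) ∩
          (fun y => -(t - (ℓ : V)) + y) ⁻¹' ZSpan.fundamentalDomain B) := by
    intro t
    -- translate by `t`
    have h1 : ZSpan.fundamentalDomain B ∩ {c | ZSpan.fract S (c + t) ∈ A} =
        (fun c => t + c) ⁻¹'
          (((fun x => -t + x) ⁻¹' ZSpan.fundamentalDomain B) ∩ ZSpan.fract S ⁻¹' A) := by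
      ext c
      simp [add_comm c t]
    rw [h1, measure_preimage_add]
    -- decompose along the translates of `P(S)`
    rw [fundS.measure_eq_tsum' (((fun x => -t + x) ⁻¹' ZSpan.fundamentalDomain B) ∩ ZSpan.fract S ⁻¹' A)]
    refine tsum_congr fun ℓ => ?_
    rw [Set.inter_assoc, preimage_fract_inter_vadd_fundamentalDomain S A ℓ, vadd_set_eq_preimage]
    -- translate by `-ℓ`
    have h2 : (fun x => -t + x) ⁻¹' ZSpan.fundamentalDomain B ∩
          (fun x => -(ℓ : V) + x) ⁻¹' (A ∩ ZSpan.fundamentalDomain S) =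
        (fun x => -(ℓ : V) + x) ⁻¹' ((A ∩ ZSpan.fundamentalDomain S) ∩
          (fun y => -(t - (ℓ : V)) + y) ⁻¹' ZSpan.fundamentalDomain B) := by
      ext x
      simp only [Set.mem_inter_iff, Set.mem_preimage]
      have : -(t - (ℓ : V)) + (-(ℓ : V) + x) = -t + x := by abel
      rw [this]
      tauto
    rw [h2, measure_preimage_add]
  simp_rw [hterm]
  -- reassemble `(t, ℓ) ↦ t - ℓ : T × L(S) ≃ L(B)`
  set f : Submodule.span ℤ (Set.range B) → ℝ≥0∞ := fun g =>
    μ ((A ∩ ZSpan.fundamentalDomain S) ∩ (fun y => -(g : V) + y) ⁻¹' ZSpan.fundamentalDomain B) with hf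
  have hbij : Function.Bijective
      (fun p : (↥T) × Submodule.span ℤ (Set.range S) =>
        (⟨(p.1 : V) - (p.2 : V), sub_mem (hT p.1.2) (hSB' p.2.2)⟩ : Submodule.span ℤ (Set.range B))) := by
    constructor
    · rintro ⟨⟨t₁, ht₁⟩, ℓ₁⟩ ⟨⟨t₂, ht₂⟩, ℓ₂⟩ h
      simp only [Subtype.mk.injEq] at h
      have ht₁₂ : t₁ - t₂ ∈ Submodule.span ℤ (Set.range S) := by
        rw [sub_eq_sub_iff_sub_eq_sub.1 h]
        exact sub_mem ℓ₁.2 ℓ₂.2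
      obtain ⟨t₀, -, ht₀⟩ := huniq t₁ (hT ht₁)
      have e1 : t₁ = t₀ := ht₀ t₁ ⟨ht₁, by simp⟩
      have e2 : t₂ = t₀ := ht₀ t₂ ⟨ht₂, ht₁₂⟩
      have het : t₁ = t₂ := e1.trans e2.symm
      subst het
      have hℓ : (ℓ₁ : V) = ℓ₂ := by rwa [sub_right_inj] at h
      simp [Subtype.ext hℓ]
    · rintro ⟨g, hg⟩
      obtain ⟨t, ⟨ht, hgt⟩, -⟩ := huniq g hg
      refine ⟨(⟨t, ht⟩, ⟨t - g, ?_⟩), ?_⟩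
      · simpa using Submodule.neg_mem _ hgt
      · simp
  have hgoal : ∑ t ∈ T, ∑' ℓ : Submodule.span ℤ (Set.range S),
      μ ((A ∩ ZSpan.fundamentalDomain S) ∩
        (fun y => -(t - (ℓ : V)) + y) ⁻¹' ZSpan.fundamentalDomain B) =
      ∑' p : (↥T) × Submodule.span ℤ (Set.range S), f (Equiv.ofBijective _ hbij p) := by
    rw [ENNReal.tsum_prod', ← Finset.tsum_subtype T (fun t => ∑' ℓ : Submodule.span ℤ (Set.range S),
      μ ((A ∩ ZSpan.fundamentalDomain S) ∩
        (fun y => -(t - (ℓ : V)) + y) ⁻¹' ZSpan.fundamentalDomain B))]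
    rfl
  rw [hgoal, (Equiv.ofBijective _ hbij).tsum_eq f, fundB.measure_eq_tsum' (A ∩ ZSpan.fundamentalDomain S)]
  refine tsum_congr fun g => ?_
  rw [hf, vadd_set_eq_preimage]

/-- **The index as a ratio of volumes** (MR07 p. 21, "sets of equal volume"): for a transversal `T`
of `L(B)/L(S)`, `#T · μ(P(B)) = μ(P(S))`, i.e. `[L(B) : L(S)] = vol P(S) / vol P(B)`.
[cite: MicciancioRegev2007, Lemma 5.8 (first property, proof p. 21)] -/
theorem card_mul_measure_fundamentalDomain_eq (B S : Basis ι ℝ V)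
    (hSB : ∀ j, S j ∈ Submodule.span ℤ (Set.range B)) {T : Finset V}
    (hT : (↑T : Set V) ⊆ Submodule.span ℤ (Set.range B))
    (huniq : ∀ x ∈ Submodule.span ℤ (Set.range B), ∃! t, t ∈ T ∧ x - t ∈ Submodule.span ℤ (Set.range S)) :
    (T.card : ℝ≥0∞) * μ (ZSpan.fundamentalDomain B) = μ (ZSpan.fundamentalDomain S) := by
  have h := sum_measure_inter_preimage_fract_eq μ B S hSB hT huniq Set.univ
  simpa using h

end Partition

/-! ### The `qⁿ` cells of `P(S)` -/

section Cells

variable (S : Basis ι ℝ V) {q : ℕ}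

omit [FiniteDimensional ℝ V] [Fintype ι] in
/-- On `P(S)` the rounded coordinates `⌊q (S⁻¹ w)ᵢ⌋` are `≥ 0`.
[cite: MicciancioRegev2007, Lemma 5.8 (step (3): `aᵢ = ⌊q S⁻¹ wᵢ⌋ ∈ ℤ_qⁿ`, p. 21)] -/
theorem floor_repr_nonneg {w : V} (hw : w ∈ ZSpan.fundamentalDomain S) (i : ι) :
    0 ≤ ⌊(q : ℝ) * S.repr w i⌋ := by
  have h := (ZSpan.mem_fundamentalDomain S).1 hw i
  exact Int.floor_nonneg.2 (mul_nonneg (Nat.cast_nonneg q) h.1)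

omit [FiniteDimensional ℝ V] [Fintype ι] in
/-- On `P(S)` the rounded coordinates `⌊q (S⁻¹ w)ᵢ⌋` are `< q`.
[cite: MicciancioRegev2007, Lemma 5.8 (step (3): `aᵢ = ⌊q S⁻¹ wᵢ⌋ ∈ ℤ_qⁿ`, p. 21)] -/
theorem floor_repr_lt (hq : 0 < q) {w : V} (hw : w ∈ ZSpan.fundamentalDomain S) (i : ι) :
    ⌊(q : ℝ) * S.repr w i⌋ < q := by
  have h := (ZSpan.mem_fundamentalDomain S).1 hw i
  rw [Int.floor_lt]
  push_cast
  calc (q : ℝ) * S.repr w i < q * 1 := mul_lt_mul_of_pos_left h.2 (by exact_mod_cast hq)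
    _ = q := mul_one _

omit [FiniteDimensional ℝ V] [Fintype ι] in
/-- A cell with label in `{0, …, q-1}ⁿ` lies inside `P(S)`.
[cite: MicciancioRegev2007, Lemma 5.8 (step (3), p. 21)] -/
theorem setOf_floor_repr_eq_subset {a : ι → ℤ} (ha : ∀ i, 0 ≤ a i ∧ a i < q) :
    {w : V | ∀ i, ⌊(q : ℝ) * S.repr w i⌋ = a i} ⊆ ZSpan.fundamentalDomain S := by
  intro w hw
  rw [ZSpan.mem_fundamentalDomain]
  intro i
  have hq : (0 : ℝ) < q := by
    have := (ha i).1.trans_lt (ha i).2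
    exact_mod_cast this
  have h1 := Int.floor_le ((q : ℝ) * S.repr w i)
  have h2 := Int.lt_floor_add_one ((q : ℝ) * S.repr w i)
  rw [hw i] at h1 h2
  have ha0 : (0 : ℝ) ≤ a i := by exact_mod_cast (ha i).1
  have haq : (a i : ℝ) + 1 ≤ q := by exact_mod_cast (ha i).2
  constructor
  · nlinarith
  · by_contra hcon
    push Not at hcon
    have : (q : ℝ) ≤ (q : ℝ) * S.repr w i := by nlinarith
    linarith

variable [MeasurableSpace V] [BorelSpace V] (μ : Measure V) [μ.IsAddHaarMeasure]

omit [FiniteDimensional ℝ V] in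
/-- **The `qⁿ` cells of `P(S)` have equal volume** (MR07 p. 20: "partitioning `P(S)` into `qⁿ`
smaller parallelepipeds"; p. 21: "it easily follows that `A` is distributed uniformly"): for `q ≥ 1`
and every `a ∈ ℤⁿ`, `μ {w | ⌊q S⁻¹ w⌋ = a} = μ(P(S)) / qⁿ` — the cell is the translate by the lattice
vector `∑ aᵢ sᵢ/q` of the fundamental parallelepiped of the basis `S/q`, of determinant `q⁻ⁿ`
relative to `S`. [cite: MicciancioRegev2007, Lemma 5.8 (first property, proof p. 21)] -/
theorem measure_setOf_floor_repr_eq [DecidableEq ι] (hq : 0 < q) (a : ι → ℤ) :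
    μ {w : V | ∀ i, ⌊(q : ℝ) * S.repr w i⌋ = a i} =
      μ (ZSpan.fundamentalDomain S) / (q : ℝ≥0∞) ^ Fintype.card ι := by
  have hq0 : (q : ℝ) ≠ 0 := by exact_mod_cast hq.ne'
  -- the basis `S/q`
  set u : ι → ℝˣ := fun _ => Units.mk0 ((q : ℝ)⁻¹) (inv_ne_zero hq0) with hu
  set S' : Basis ι ℝ V := S.unitsSMul u with hS'
  have hrepr : ∀ (x : V) (i : ι), S'.repr x i = (q : ℝ) * S.repr x i := by
    intro x i
    rw [hS', Basis.repr_unitsSMul, hu]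
    simp [Units.smul_def]
  -- the cell is a translate of `P(S/q)` by a vector of `L(S/q)`
  set v : Submodule.span ℤ (Set.range S') :=
    ∑ i, a i • (⟨S' i, Submodule.subset_span ⟨i, rfl⟩⟩ : Submodule.span ℤ (Set.range S')) with hv
  have hvrepr : ∀ i, S'.repr (v : V) i = a i := by
    intro i
    rw [hv]
    simp [Finsupp.single_apply]
  have hcell : {w : V | ∀ i, ⌊(q : ℝ) * S.repr w i⌋ = a i} =
      (v +ᵥ ZSpan.fundamentalDomain S' : Set V) := by
    ext w
    rw [Set.mem_vadd_set_iff_neg_vadd_mem, ZSpan.vadd_mem_fundamentalDomain, neg_inj, Set.mem_setOf_eq]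
    constructor
    · intro h
      apply Subtype.ext
      apply S'.repr.injective
      ext i
      rw [hvrepr, ZSpan.repr_floor_apply, hrepr, h i]
    · intro h i
      have := congrArg (fun z : Submodule.span ℤ (Set.range S') => S'.repr (z : V) i) h
      rw [hvrepr, ZSpan.repr_floor_apply, hrepr] at this
      exact_mod_cast this.symm
  have : MeasurableVAdd (Submodule.span ℤ (Set.range S')) V :=
    (inferInstance : MeasurableVAdd (Submodule.span ℤ (Set.range S')).toAddSubgroup V)
  have : VAddInvariantMeasure (Submodule.span ℤ (Set.range S')) V μ :=
    (inferInstance : VAddInvariantMeasure (Submodule.span ℤ (Set.range S')).toAddSubgroup V μ)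
  rw [hcell, measure_vadd, ZSpan.measure_fundamentalDomain S' μ S, hS', Basis.det_unitsSMul_self]
  simp only [hu, Units.val_mk0, Finset.prod_const, Finset.card_univ]
  rw [abs_of_nonneg (by positivity), ENNReal.ofReal_pow (by positivity),
    ENNReal.ofReal_inv_of_pos (by positivity), ENNReal.ofReal_natCast, ENNReal.div_eq_inv_mul,
    ENNReal.inv_pow]

/-- Measurability of a cell. [folklore] -/
theorem measurableSet_setOf_floor_repr_eq (q : ℕ) (a : ι → ℤ) :
    MeasurableSet {w : V | ∀ i, ⌊(q : ℝ) * S.repr w i⌋ = a i} := by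
  have : {w : V | ∀ i, ⌊(q : ℝ) * S.repr w i⌋ = a i} =
      ⋂ i, (fun w => ⌊(q : ℝ) * S.repr w i⌋) ⁻¹' {a i} := by
    ext w; simp
  rw [this]
  refine MeasurableSet.iInter fun i => ?_
  refine measurableSet_preimage (Int.measurable_floor.comp ?_) (measurableSet_singleton _)
  exact (continuous_const.mul ((S.coord i).continuous_of_finiteDimensional)).measurable

/-- Measurability of the event "the query column built from `(c, v) ↦ c + t` is `a`", for a fixed
shift `t`. [folklore] -/
theorem measurableSet_setOf_floor_repr_fract_add_eq (q : ℕ) (a : ι → ℤ) (t : V) :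
    MeasurableSet {x : V | ∀ i, ⌊(q : ℝ) * S.repr (ZSpan.fract S (x + t)) i⌋ = a i} := by
  have : {x : V | ∀ i, ⌊(q : ℝ) * S.repr (ZSpan.fract S (x + t)) i⌋ = a i} =
      ⋂ i, (fun x : V => ⌊(q : ℝ) * Int.fract (S.repr x i + S.repr t i)⌋) ⁻¹' {a i} := by
    ext x
    simp [ZSpan.repr_fract_apply]
  rw [this]
  refine MeasurableSet.iInter fun i => ?_
  refine measurableSet_preimage (Int.measurable_floor.comp (measurable_const.mul ?_))
    (measurableSet_singleton _)
  have hc : Measurable fun x : V => S.repr x i := (S.coord i).continuous_of_finiteDimensional.measurable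
  exact measurable_fract.comp (hc.add measurable_const)

end Cells

/-! ### The first property of Lemma 5.8 -/

section Query

variable [MeasurableSpace V] [BorelSpace V] (μ : Measure V) [μ.IsAddHaarMeasure]
variable {Ω : Type*} [MeasurableSpace Ω] {P : Measure Ω} [IsProbabilityMeasure P]

/-- **MR07 Lemma 5.8, first property, for one column** (p. 21: "if `c` is uniformly distributed in
`P(B)` and `v` is chosen uniformly from the vectors in `L(B) mod P(S)`, then `c + v mod P(S)` is
distributed uniformly in `P(S)` … it easily follows that `A` is distributed uniformly in
`ℤ_q^{n×m}`"): on a probability space, let `c` have the uniform law `μ[·|P(B)]` on `P(B)`, let `v`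
be uniform on a transversal `T` of `L(B)/L(S)` and independent of `c`; then for every `q ≥ 1` and
`a ∈ {0, …, q-1}ⁿ`, `Pr[⌊q S⁻¹((c + v) mod P(S))⌋ = a] = q⁻ⁿ`.
[cite: MicciancioRegev2007, Lemma 5.8 (first property, proof p. 21)] -/
theorem measure_query_eq [DecidableEq ι] (B S : Basis ι ℝ V)
    (hSB : ∀ j, S j ∈ Submodule.span ℤ (Set.range B))
    {T : Finset V} (hT : (↑T : Set V) ⊆ Submodule.span ℤ (Set.range B))
    (huniq : ∀ x ∈ Submodule.span ℤ (Set.range B), ∃! t, t ∈ T ∧ x - t ∈ Submodule.span ℤ (Set.range S))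
    {q : ℕ} (hq : 0 < q) {c v : Ω → V} (hcm : Measurable c) (hvm : Measurable v)
    (hind : IndepFun c v P) (hc : P.map c = μ[|ZSpan.fundamentalDomain B])
    (hv : ∀ t ∈ T, P (v ⁻¹' {t}) = ((T.card : ℝ≥0∞))⁻¹)
    {a : ι → ℤ} (ha : ∀ i, 0 ≤ a i ∧ a i < q) :
    P {ω | ∀ i, ⌊(q : ℝ) * S.repr (ZSpan.fract S (c ω + v ω)) i⌋ = a i} =
      ((q : ℝ≥0∞) ^ Fintype.card ι)⁻¹ := by
  classical
  have hTne : T.Nonempty := transversal_nonempty B S huniq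
  have hcard : (T.card : ℝ≥0∞) ≠ 0 := by exact_mod_cast hTne.card_pos.ne'
  have hFB0 : μ (ZSpan.fundamentalDomain B) ≠ 0 := ZSpan.measure_fundamentalDomain_ne_zero B
  have hFBfin : μ (ZSpan.fundamentalDomain B) ≠ ∞ :=
    (ZSpan.fundamentalDomain_isBounded B).measure_lt_top.ne
  -- `v ∈ T` almost surely
  have hvT : P (v ⁻¹' (↑T : Set V))ᶜ = 0 := by
    rw [prob_compl_eq_zero_iff (hvm T.measurableSet)]
    have : v ⁻¹' (↑T : Set V) = ⋃ t ∈ T, v ⁻¹' {t} := by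
      ext ω
      simp
    rw [this, measure_biUnion_finset]
    · rw [Finset.sum_congr rfl hv, Finset.sum_const, nsmul_eq_mul,
        ENNReal.mul_inv_cancel hcard (ENNReal.natCast_ne_top _)]
    · intro t _ t' _ htt'
      exact Set.disjoint_left.2 fun ω h h' => htt' (h.symm.trans h')
    · exact fun t _ => hvm (measurableSet_singleton t)
  -- the event, decomposed along the values of `v`
  set D : V → Set V := fun t => {x | ∀ i, ⌊(q : ℝ) * S.repr (ZSpan.fract S (x + t)) i⌋ = a i}
    with hD
  have hDm : ∀ t, MeasurableSet (D t) := fun t => measurableSet_setOf_floor_repr_fract_add_eq S q a t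
  have hE : P {ω | ∀ i, ⌊(q : ℝ) * S.repr (ZSpan.fract S (c ω + v ω)) i⌋ = a i} =
      ∑ t ∈ T, P (c ⁻¹' D t ∩ v ⁻¹' {t}) := by
    have h1 : P {ω | ∀ i, ⌊(q : ℝ) * S.repr (ZSpan.fract S (c ω + v ω)) i⌋ = a i} =
        P ({ω | ∀ i, ⌊(q : ℝ) * S.repr (ZSpan.fract S (c ω + v ω)) i⌋ = a i} ∩ v ⁻¹' ↑T) := by
      rw [← measure_inter_add_sdiff _ (hvm T.measurableSet),
        measure_mono_null (Set.sdiff_subset_compl _ _) hvT, add_zero]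
    have h2 : {ω | ∀ i, ⌊(q : ℝ) * S.repr (ZSpan.fract S (c ω + v ω)) i⌋ = a i} ∩ v ⁻¹' ↑T =
        ⋃ t ∈ T, (c ⁻¹' D t ∩ v ⁻¹' {t}) := by
      ext ω
      simp only [Set.mem_inter_iff, Set.mem_preimage, Finset.mem_coe, Set.mem_iUnion,
        Set.mem_singleton_iff, exists_prop, Set.mem_setOf_eq, hD]
      constructor
      · rintro ⟨hωE, hωT⟩
        exact ⟨v ω, hωT, hωE, rfl⟩
      · rintro ⟨t, ht, hωD, rfl⟩
        exact ⟨hωD, ht⟩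
    rw [h1, h2, measure_biUnion_finset]
    · intro t _ t' _ htt'
      exact Set.disjoint_left.2 fun ω h h' => htt' (h.2.symm.trans h'.2)
    · exact fun t _ => (hcm (hDm t)).inter (hvm (measurableSet_singleton t))
  -- independence and the two laws
  have hE2 : ∀ t ∈ T, P (c ⁻¹' D t ∩ v ⁻¹' {t}) =
      (μ (ZSpan.fundamentalDomain B))⁻¹ * μ (ZSpan.fundamentalDomain B ∩ D t) * ((T.card : ℝ≥0∞))⁻¹ := by
    intro t ht
    rw [hind.measure_inter_preimage_eq_mul _ _ (hDm t) (measurableSet_singleton t), hv t ht,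
      ← Measure.map_apply hcm (hDm t), hc, cond_apply (ZSpan.fundamentalDomain_measurableSet B)]
  rw [hE, Finset.sum_congr rfl hE2, ← Finset.sum_mul, ← Finset.mul_sum]
  -- the partition of `P(S)` and the cells
  have hsum : ∑ t ∈ T, μ (ZSpan.fundamentalDomain B ∩ D t) =
      μ (ZSpan.fundamentalDomain S) / (q : ℝ≥0∞) ^ Fintype.card ι := by
    have h := sum_measure_inter_preimage_fract_eq μ B S hSB hT huniq
      {w : V | ∀ i, ⌊(q : ℝ) * S.repr w i⌋ = a i}
    rw [Set.inter_eq_left.2 (setOf_floor_repr_eq_subset S ha), measure_setOf_floor_repr_eq S μ hq a] at h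
    exact h
  rw [hsum, ← card_mul_measure_fundamentalDomain_eq μ B S hSB hT huniq, ENNReal.div_eq_inv_mul]
  calc (μ (ZSpan.fundamentalDomain B))⁻¹ *
        (((q : ℝ≥0∞) ^ Fintype.card ι)⁻¹ * ((T.card : ℝ≥0∞) * μ (ZSpan.fundamentalDomain B))) *
        ((T.card : ℝ≥0∞))⁻¹
      = ((q : ℝ≥0∞) ^ Fintype.card ι)⁻¹ *
          ((μ (ZSpan.fundamentalDomain B))⁻¹ * μ (ZSpan.fundamentalDomain B)) *
          (((T.card : ℝ≥0∞))⁻¹ * (T.card : ℝ≥0∞)) := by ring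
    _ = ((q : ℝ≥0∞) ^ Fintype.card ι)⁻¹ := by
      rw [ENNReal.inv_mul_cancel hFB0 hFBfin, ENNReal.inv_mul_cancel hcard (ENNReal.natCast_ne_top _),
        mul_one, mul_one]

/-- **MR07 Lemma 5.8, first property** (p. 20: "if the input matrix `C ∈ P(B)ᵐ` is distributed
uniformly at random, then the query matrix `A ∈ ℤ_q^{n×m}` is also uniformly distributed"; proof
p. 21: "… `W` is distributed uniformly in `P(S)ᵐ`. From this, it easily follows that `A` is
distributed uniformly in `ℤ_q^{n×m}`"): if the pairs `(cₖ, vₖ)` are independent across the columns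
`k`, and in each column `cₖ` is uniform on `P(B)`, `vₖ` uniform on the transversal `T` and
independent of `cₖ` (step (1) uses fresh coins), then for every `q ≥ 1` the query matrix
`A = (⌊q S⁻¹((cₖ + vₖ) mod P(S))⌋)ₖ` takes each value in `{0, …, q-1}^{n×m}` with probability
`q^{-nm}`. [cite: MicciancioRegev2007, Lemma 5.8 (first property, pp. 20–21)] -/
theorem measure_queryMatrix_eq [DecidableEq ι] {κ : Type*} [Fintype κ] (B S : Basis ι ℝ V)
    (hSB : ∀ j, S j ∈ Submodule.span ℤ (Set.range B))
    {T : Finset V} (hT : (↑T : Set V) ⊆ Submodule.span ℤ (Set.range B))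
    (huniq : ∀ x ∈ Submodule.span ℤ (Set.range B), ∃! t, t ∈ T ∧ x - t ∈ Submodule.span ℤ (Set.range S))
    {q : ℕ} (hq : 0 < q) {c v : κ → Ω → V} (hcm : ∀ k, Measurable (c k)) (hvm : ∀ k, Measurable (v k))
    (hpairs : iIndepFun (fun k ω => (c k ω, v k ω)) P)
    (hind : ∀ k, IndepFun (c k) (v k) P) (hc : ∀ k, P.map (c k) = μ[|ZSpan.fundamentalDomain B])
    (hv : ∀ k, ∀ t ∈ T, P (v k ⁻¹' {t}) = ((T.card : ℝ≥0∞))⁻¹)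
    {a : κ → ι → ℤ} (ha : ∀ k i, 0 ≤ a k i ∧ a k i < q) :
    P {ω | ∀ k i, ⌊(q : ℝ) * S.repr (ZSpan.fract S (c k ω + v k ω)) i⌋ = a k i} =
      ((q : ℝ≥0∞) ^ (Fintype.card ι * Fintype.card κ))⁻¹ := by
  classical
  -- the event is the intersection over `k` of events about the pair `(c k, v k)`
  set D : κ → Set (V × V) := fun k =>
    {p | ∀ i, ⌊(q : ℝ) * S.repr (ZSpan.fract S (p.1 + p.2)) i⌋ = a k i} with hD
  have hDm : ∀ k, MeasurableSet (D k) := by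
    intro k
    have : D k = ⋂ i, (fun p : V × V => ⌊(q : ℝ) * Int.fract (S.repr p.1 i + S.repr p.2 i)⌋) ⁻¹' {a k i} := by
      ext p
      simp [hD, ZSpan.repr_fract_apply]
    rw [this]
    refine MeasurableSet.iInter fun i => ?_
    refine measurableSet_preimage (Int.measurable_floor.comp (measurable_const.mul ?_))
      (measurableSet_singleton _)
    have hco : Measurable fun x : V => S.repr x i := (S.coord i).continuous_of_finiteDimensional.measurable
    exact measurable_fract.comp ((hco.comp measurable_fst).add (hco.comp measurable_snd))
  have hE : {ω | ∀ k i, ⌊(q : ℝ) * S.repr (ZSpan.fract S (c k ω + v k ω)) i⌋ = a k i} =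
      ⋂ k ∈ (Finset.univ : Finset κ), (fun ω => (c k ω, v k ω)) ⁻¹' D k := by
    ext ω
    simp [hD]
  rw [hE, hpairs.measure_inter_preimage_eq_mul Finset.univ (fun k _ => hDm k)]
  have hk : ∀ k, P ((fun ω => (c k ω, v k ω)) ⁻¹' D k) = ((q : ℝ≥0∞) ^ Fintype.card ι)⁻¹ := by
    intro k
    have := measure_query_eq μ B S hSB hT huniq hq (hcm k) (hvm k) (hind k) (hc k) (hv k) (ha k)
    rw [← this]
    rfl
  simp only [hk, Finset.prod_const, Finset.card_univ]
  rw [← ENNReal.inv_pow, ← pow_mul]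

end Query

end MicciancioRegev2007

end Literature.Algebra.EuclideanLattices

end
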